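/-
Copyright: cell `pub-ymgap` (HUMAN RULING D-0062), Track A of `YM-PLAN.md`, DAG node N20 (= NE7b); R134 acceleration seat
`pub-ymgap-dag-n20-c` (strategy s1, generation 4), module 19.  Released under the licence of the surrounding project.
-/
import Summits.QuantumFields.YangMills.Theorems.BalabanUVNodesN20LCSLargeFieldFirstStep
import Summits.QuantumFields.YangMills.Theorems.BalabanUVNodesN20LCSAvgCellPeierls
import HarnessLib

/-!
# YM-DAG node N20 (= NE7b), strategy s1, module 19: PINNED FAMILIES OF (3.2) LARGE-FIELD CUBES AT THE STEP WEIGHTS OF RECORD —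
# ONE COMPLEMENT FACTOR, AND AT THE FIRST STEP ONE PEIERLS FACTOR, PER PINNED CUBE

Track A of `YM-PLAN.md` (cell `pub-ymgap`, HUMAN RULING D-0062), node **N20** = spine estimate NE7b (`T4WeightBudget.RelWeightBound` — NOT PRINTED,
NOT PROVED).  Seat `pub-ymgap-dag-n20-c` (R134, s1), generation 4, module 19 (17 = `…N20LCSLargeFieldLabels`, 18 = `…N20LCSLargeFieldFirstStep`).
Kernel theorems only: 0 `def`, 0 `sorry`, standard axioms; COUNT-NEUTRAL; `--supports` the K3‴ item.  Nothing of Bałaban's is asserted.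

WHY.  The (α)-road's count is a COST–VOLUME inequality along a pinned genealogy (`LocalConditionalStability.sum_admS_integral_le_of_LCS`: «the
extracted cost beats the stability volume cost»): what it consumes from a pinned step is an extracted exponent LINEAR IN THE NUMBER OF PINNED
LARGE-FIELD CELLS — print's «the factor connected with Z in the form exp(−κ_j(Z) − 2p₀(g_{j(Z)}))» ([Balaban1989LargeFieldII] (1.79)–(1.80)
pp. 383–384), one `exp(−p₀(g))` per large-field cube ([Balaban1989LargeFieldI] (0.1) p. 175).  Modules 17–18 pinned ONE cube.  THIS FILE pins a FINITE
FAMILY `D` of χ_{k+1}-cubes inside the new large-field family `P_{k+1}` of the labels of NODE 00's step weights of record: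
* §0 `sum_ite_superset_subset`: the two-factor expansion summed over the labels CONTAINING `D` is `Π_{c∈D} g c` (kill the `f`-factor on `D`,
  `Finset.prod_add`);
* §1 ★ **`sum_aWeight_filter_superset`** (`Σ_{P ⊇ D} a(P)(V′) = Π_{c∈D}(1 − χ_{k+1}(c)(V′))` on the (3.2) range), ★★
  **`abs_sum_ωOfRecord_filter_superset_le`** (modulo `IsZetaAbsLeOne`: `|Σ_{t : D ⊆ P(t)} ω s t (U,V′)| ≤ Π_{c∈D}(1 − χ_{k+1}(c)(V′))` — ONE
  COMPLEMENT FACTOR PER PINNED CUBE, pointwise, every step, every old sequence), `prod_one_sub_chiFactor_anti` (a family with overlapping letter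
  regions is bounded through any sub-family);
* §2 **`prod_one_sub_chiFactor_le_indicator`**: under the regularity letters of the pinned cubes ([Balaban1985PropagatorsII] Thm 1 shape, DISPLAYED
  per cube with regions `R c` and a common threshold `ε″`), `Π_{c∈D}(1 − χ_{k+1}(c)(V′)) ≤ 𝟙[∀ c ∈ D, ∃ p′ ∈ R c, ε″ ≤ |V′(∂p′) − 1|]` — a
  SIMULTANEOUS coarse large-field event, one witness plaquette per pinned cube (the shape of n20-d's `measureReal_forall_exists_le_pow`);
* §3 ★ **`abs_integral_sum_ωOfRecord_filter_superset_mul_le`** (on the graph `V′ = Ū`, any step, any integrable old piece `f ≥ 0`: the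
  family-pinned labels weigh at most the `f`-mass of the simultaneous event) and ★★★ **`abs_integral_pinnedLargeFamily_rhoZero_le`** — THE
  FIRST STEP: with the `δ₀ > 0`, `C ≥ 0` of n20-d's `N20LCSAvgCellPeierls.gibbsMeasure_largeFieldCells_dist1_avgFun_le`, for PAIRWISE DISJOINT
  letter regions of at most `m` plaquettes each,
  `|∫ (Σ_{t : D ⊆ P(t)} ω s t (U,Ū)) ρ₀ dU| ≤ (m · e^{C·δ₀ − δ₀·g₀⁻²·ε″²∕(2N)})^{#D} · ∫ ρ₀ dU`
  — ONE PEIERLS FACTOR PER PINNED CUBE, i.e. an extracted exponent `#D · (δ₀g₀⁻²ε″²∕(2N) − Cδ₀ − log m)` against the term's own mass at the first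
  step: the cost side of the (α)-road's bookkeeping for the pinned (3.2) labels, `β = g₀⁻²`-explicit, volume-uniform.

HONEST FRAMING.  Conditional on the DISPLAYED letters `IsZetaAbsLeOne` and `hreg` (per pinned cube; [Balaban1985PropagatorsII] Thm 1 NOT asserted, NOT
proved) and on the DISJOINTNESS of the letter regions (the consumer sparsifies a general family through `prod_one_sub_chiFactor_anti`); LABEL level
(the tower's choice index is the resummed sequence — collar labels, the (3.3) labels and the inherited region `Z_k` are NOT extracted: (3.12)–(3.19),
the key-pattern READING, RR-1 ∕ (A1c)); steps `k ≥ 1` REDUCED (§3, first theorem) not proved («LCS-j»).  NE7b NOT PRINTED ∕ NOT PROVED; (α)-instance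
0∕1; N20 NOT discharged; typed 28∕28, discharged count untouched; one finite four-torus at fixed `ε` — NOT ℝ⁴, NOT infinite volume, NOT OS, NOT a
mass gap, NOT Clay.

References: T. Bałaban, CMP 119 (1988) 243–285 [Balaban1988Convergent] ((3.2) p. 265); CMP 99 (1985) 389–434 [Balaban1985PropagatorsII] (Thm 1);
CMP 122 (1989) 175–202 [Balaban1989LargeFieldI] ((0.1) p. 175); CMP 122 (1989) 355–392 [Balaban1989LargeFieldII] ((1.79)–(1.80) pp. 383–384).
-/

set_option autoImplicit false

noncomputable section

open scoped BigOperators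

namespace Summit.QuantumFields.YangMills.BalabanUVNodes.N20LCSLargeFieldFamilies

open MeasureTheory
open Literature.MathematicalPhysics.QuantumFieldTheory.Balaban1983to89
open Literature.MathematicalPhysics.QuantumFieldTheory.Balaban1983to89.T4Continuum
open Literature.MathematicalPhysics.QuantumFieldTheory.Balaban1983to89.Node00
open Summit.QuantumFields.YangMills.BalabanUVNodes.N20LCSLargeFieldLabels
  (sum_ite_subset_prod_sdiff_mul_prod aWeight_eq abs_ωOfRecord)
open Summit.QuantumFields.YangMills.BalabanUVNodes.N20LCSLargeFieldFirstStep
  (measurableSet_largeField setIntegral_rhoZeroOfRecord)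

/-! ## §0 The two-factor expansion summed over the labels CONTAINING a fixed set -/

section Algebra

variable {ι : Type*} [Fintype ι] [DecidableEq ι]

/-- **THE DECOMPOSITION OF UNITY SUMMED OVER THE LABELS CONTAINING `D`** (`g + f = 1` on `C`):
`Σ_{X : D ⊆ X ⊆ C} (Π_{C∖X} f)(Π_X g) = Π_{c∈D} g c` if `D ⊆ C`, and `= 0` otherwise — kill the `f`-factor on `D`
(`f′ = 𝟙[· ∉ D]·f`), expand `Π_C (g + f′)` by `Finset.prod_add`. [folklore] -/
theorem sum_ite_superset_subset (C D : Finset ι) (f g : ι → ℝ) (hfg : ∀ i ∈ C, g i + f i = 1) :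
    (∑ X : Finset ι, if D ⊆ X then (if X ⊆ C then (∏ i ∈ C \ X, f i) * ∏ i ∈ X, g i else 0) else 0) =
      if D ⊆ C then ∏ i ∈ D, g i else 0 := by
  by_cases hDC : D ⊆ C
  · rw [if_pos hDC]
    -- the modified weight `f′`
    set f' : ι → ℝ := fun i => if i ∈ D then 0 else f i with hf'
    have key : ∀ X : Finset ι,
        (if D ⊆ X then (if X ⊆ C then (∏ i ∈ C \ X, f i) * ∏ i ∈ X, g i else 0) else 0) =
          if X ⊆ C then (∏ i ∈ C \ X, f' i) * ∏ i ∈ X, g i else 0 := by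
      intro X
      by_cases hXC : X ⊆ C
      · rw [if_pos hXC]
        by_cases hDX : D ⊆ X
        · rw [if_pos hDX, if_pos hXC]
          congr 1
          refine Finset.prod_congr rfl fun i hi => ?_
          have hiD : i ∉ D := fun h => (Finset.mem_sdiff.1 hi).2 (hDX h)
          simp only [hf', if_neg hiD]
        · rw [if_neg hDX, if_pos hXC]
          obtain ⟨c, hcD, hcX⟩ := Finset.not_subset.1 hDX
          rw [Finset.prod_eq_zero (Finset.mem_sdiff.2 ⟨hDC hcD, hcX⟩) (by simp only [hf', if_pos hcD]), zero_mul]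
      · rw [if_neg hXC]
        split_ifs <;> rfl
    simp_rw [key]
    rw [sum_ite_subset_prod_sdiff_mul_prod, ← Finset.prod_sdiff hDC]
    have h1 : ∏ i ∈ C \ D, (g i + f' i) = 1 := Finset.prod_eq_one fun i hi => by
      have hiD : i ∉ D := (Finset.mem_sdiff.1 hi).2
      simp only [hf', if_neg hiD]
      exact hfg i (Finset.mem_sdiff.1 hi).1
    have h2 : ∏ i ∈ D, (g i + f' i) = ∏ i ∈ D, g i := Finset.prod_congr rfl fun i hi => by
      simp only [hf', if_pos hi, add_zero]
    rw [h1, h2, one_mul]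
  · rw [if_neg hDC]
    refine Finset.sum_eq_zero fun X _ => ?_
    by_cases hDX : D ⊆ X
    · rw [if_pos hDX, if_neg]
      exact fun hXC => hDC (hDX.trans hXC)
    · rw [if_neg hDX]

end Algebra

/-! ## §1 The labels whose new large-field family contains a SET of cubes, pointwise -/

section Labels

variable (F : T4Family) (N : ℕ) [NeZero N] (ν : Stage7Numerics) (M : ℕ) (p : B12.RunParams) (g : ℕ → ℝ) (k : ℕ)

/-- **THE (3.2) LABELS CONTAINING A FAMILY `D` OF CUBES SUM TO THE PRODUCT OF ITS COMPLEMENT FACTORS**: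
`Σ_{P ⊇ D} a(P)(V′) = Π_{c∈D} (1 − χ_{k+1}(c)(V′))` if `D` lies in the (3.2) range, `= 0` otherwise. [folklore] -/
theorem sum_aWeight_filter_superset (s : SeqOfRecord F ν M g p.K k) (D : Finset (Iχ F ν p g k))
    (V' : GaugeField (F.P p.K) (k + 1) (SU N)) :
    ∑ Pl ∈ Finset.univ.filter (fun Pl : Finset (Iχ F ν p g k) => D ⊆ Pl), aWeight F N ν M p g k s Pl V' =
      if D ⊆ cubes32 F ν M p g k s then ∏ c ∈ D, (1 - chiFactor F N ν p g k c V') else 0 := by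
  rw [Finset.sum_filter]
  simp_rw [aWeight_eq]
  exact sum_ite_superset_subset (cubes32 F ν M p g k s) D (fun c => chiFactor F N ν p g k c V')
    (fun c => 1 - chiFactor F N ν p g k c V') (fun _ _ => by ring)

/-- The product of complement factors lies in `[0, 1]`. [folklore] -/
theorem prod_one_sub_chiFactor_mem (D : Finset (Iχ F ν p g k)) (V' : GaugeField (F.P p.K) (k + 1) (SU N)) :
    0 ≤ ∏ c ∈ D, (1 - chiFactor F N ν p g k c V') ∧ ∏ c ∈ D, (1 - chiFactor F N ν p g k c V') ≤ 1 :=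
  ⟨Finset.prod_nonneg fun c _ => sub_nonneg.2 (chiFactor_le_one F N ν p g k c V'),
    Finset.prod_le_one (fun c _ => sub_nonneg.2 (chiFactor_le_one F N ν p g k c V'))
      fun c _ => sub_le_self _ (chiFactor_nonneg F N ν p g k c V')⟩

/-- The family-pinned (3.2) sum is at most the product of the complement factors. [folklore] -/
theorem sum_aWeight_filter_superset_le (s : SeqOfRecord F ν M g p.K k) (D : Finset (Iχ F ν p g k))
    (V' : GaugeField (F.P p.K) (k + 1) (SU N)) :
    ∑ Pl ∈ Finset.univ.filter (fun Pl : Finset (Iχ F ν p g k) => D ⊆ Pl), aWeight F N ν M p g k s Pl V' ≤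
      ∏ c ∈ D, (1 - chiFactor F N ν p g k c V') := by
  rw [sum_aWeight_filter_superset]
  split_ifs
  · exact le_rfl
  · exact (prod_one_sub_chiFactor_mem F N ν p g k D V').1

/-- **LABEL-LEVEL POINTWISE EXTRACTION FOR A PINNED FAMILY OF (3.2) LARGE-FIELD CUBES**: modulo `IsZetaAbsLeOne`,
`|Σ_{t : D ⊆ P(t)} ω s t (U,V′)| ≤ Π_{c∈D} (1 − χ_{k+1}(c)(V′))` — one complement factor PER PINNED CUBE (print: one factor
`exp(−p₀(g_k))` per large-field cube, [Balaban1989LargeFieldII] p. 383; [Balaban1989LargeFieldI] (0.1)). [folklore] -/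
theorem abs_sum_ωOfRecord_filter_superset_le (A₁ : ℝ) {ζ : ZetaOfRecord F N ν M} (hζ : IsZetaAbsLeOne F N ν M ζ)
    (s : SeqOfRecord F ν M g p.K k) (D : Finset (Iχ F ν p g k))
    (U : GaugeField (F.P p.K) k (SU N)) (V' : GaugeField (F.P p.K) (k + 1) (SU N)) :
    |∑ t ∈ Finset.univ.filter (fun t : LbOfRecord F ν p g k => D ⊆ t.1), ωOfRecord F N ν M p g k A₁ ζ s t U V'| ≤
      ∏ c ∈ D, (1 - chiFactor F N ν p g k c V') := by
  classical
  set aPin : Finset (Iχ F ν p g k) → ℝ := fun Pl => if D ⊆ Pl then aWeight F N ν M p g k s Pl V' else 0 with haPin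
  have haPin0 : ∀ Pl, 0 ≤ aPin Pl := fun Pl => by
    simp only [haPin]; split_ifs
    · exact aWeight_nonneg F N ν M p g k s Pl V'
    · exact le_rfl
  have hz : ∀ Pl Ql : Finset (Iχ F ν p g k), ∑ R, ∑ S, |ζ p g k s Pl Ql (R, S) U V'| ≤ 1 := fun Pl Ql => by
    have h := hζ p g k s Pl Ql U V'
    rwa [Fintype.sum_prod_type] at h
  have key : ∀ t : LbOfRecord F ν p g k,
      (if D ⊆ t.1 then |ωOfRecord F N ν M p g k A₁ ζ s t U V'| else 0) =
        aPin t.1 * (bWeight F N ν M p g k A₁ s t.1 t.2.1 U V' * |ζ p g k s t.1 t.2.1 t.2.2 U V'|) := by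
    intro t
    simp only [haPin]
    split_ifs
    · exact abs_ωOfRecord F N ν M p g k A₁ ζ s t U V'
    · rw [zero_mul]
  calc |∑ t ∈ Finset.univ.filter (fun t : LbOfRecord F ν p g k => D ⊆ t.1), ωOfRecord F N ν M p g k A₁ ζ s t U V'|
      ≤ ∑ t ∈ Finset.univ.filter (fun t : LbOfRecord F ν p g k => D ⊆ t.1), |ωOfRecord F N ν M p g k A₁ ζ s t U V'| :=
        Finset.abs_sum_le_sum_abs _ _
    _ = ∑ t : LbOfRecord F ν p g k, aPin t.1 * (bWeight F N ν M p g k A₁ s t.1 t.2.1 U V' * |ζ p g k s t.1 t.2.1 t.2.2 U V'|) := by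
        rw [Finset.sum_filter]
        exact Finset.sum_congr rfl fun t _ => key t
    _ = ∑ Pl, ∑ Ql, ∑ R, ∑ S, aPin Pl * (bWeight F N ν M p g k A₁ s Pl Ql U V' * |ζ p g k s Pl Ql (R, S) U V'|) := by
        simp only [Fintype.sum_prod_type]
    _ = ∑ Pl, aPin Pl * ∑ Ql, bWeight F N ν M p g k A₁ s Pl Ql U V' * ∑ R, ∑ S, |ζ p g k s Pl Ql (R, S) U V'| := by
        simp only [Finset.mul_sum]
    _ ≤ ∑ Pl, aPin Pl * ∑ Ql, bWeight F N ν M p g k A₁ s Pl Ql U V' * 1 := by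
        refine Finset.sum_le_sum fun Pl _ => mul_le_mul_of_nonneg_left ?_ (haPin0 Pl)
        exact Finset.sum_le_sum fun Ql _ =>
          mul_le_mul_of_nonneg_left (hz Pl Ql) (bWeight_nonneg F N ν M p g k A₁ s Pl Ql U V')
    _ = ∑ Pl ∈ Finset.univ.filter (fun Pl : Finset (Iχ F ν p g k) => D ⊆ Pl), aWeight F N ν M p g k s Pl V' := by
        simp only [mul_one, sum_bWeight, haPin]
        rw [Finset.sum_filter]
    _ ≤ ∏ c ∈ D, (1 - chiFactor F N ν p g k c V') := sum_aWeight_filter_superset_le F N ν M p g k s D V'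

/-- Dropping pinned cubes only loosens the bound: `Π_{c∈D}(1 − χ(c)) ≤ Π_{c∈D′}(1 − χ(c))` for `D′ ⊆ D` (factors in `[0,1]`) — a family
with OVERLAPPING regularity regions is bounded through any sub-family with disjoint ones. [folklore] -/
theorem prod_one_sub_chiFactor_anti {D D' : Finset (Iχ F ν p g k)} (h : D' ⊆ D) (V' : GaugeField (F.P p.K) (k + 1) (SU N)) :
    ∏ c ∈ D, (1 - chiFactor F N ν p g k c V') ≤ ∏ c ∈ D', (1 - chiFactor F N ν p g k c V') := by
  rw [← Finset.prod_sdiff h]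
  exact mul_le_of_le_one_left (prod_one_sub_chiFactor_mem F N ν p g k D' V').1
    (prod_one_sub_chiFactor_mem F N ν p g k (D \ D') V').2

end Labels

/-! ## §2 Under the regularity letters of the pinned cubes: a SIMULTANEOUS coarse large-field event -/

section Letter

variable (F : T4Family) (N : ℕ) [NeZero N] (ν : Stage7Numerics) (M : ℕ) (p : B12.RunParams) (g : ℕ → ℝ) (k : ℕ)

/-- **THE PRODUCT OF COMPLEMENT FACTORS UNDER THE REGULARITY LETTERS.**  If every pinned cube `c ∈ D` carries its regularity letter with region
`R c` and a common threshold `ε″` (`hreg`), then pointwise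
`Π_{c∈D} (1 − χ_{k+1}(c)(V′)) ≤ 𝟙[∀ c ∈ D, ∃ p′ ∈ R c, ε″ ≤ |V′(∂p′) − 1|]` — every pinned cube has a LARGE coarse plaquette of the new field in
its own region. [folklore] -/
theorem prod_one_sub_chiFactor_le_indicator (D : Finset (Iχ F ν p g k)) (R : Iχ F ν p g k → Finset (Plaq (F.P p.K) (k + 1)))
    (ε'' : ℝ)
    (hreg : ∀ c ∈ D, ∀ V' : GaugeField (F.P p.K) (k + 1) (SU N),
      (∀ p' ∈ R c, dist1 (GaugeField.plaqHol V' p') < ε'') → chiFactor F N ν p g k c V' = 1)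
    (V' : GaugeField (F.P p.K) (k + 1) (SU N)) :
    ∏ c ∈ D, (1 - chiFactor F N ν p g k c V') ≤
      Set.indicator {V' : GaugeField (F.P p.K) (k + 1) (SU N) | ∀ c ∈ D, ∃ p' ∈ R c, ε'' ≤ dist1 (GaugeField.plaqHol V' p')}
        (fun _ => (1 : ℝ)) V' := by
  by_cases h : ∀ c ∈ D, ∃ p' ∈ R c, ε'' ≤ dist1 (GaugeField.plaqHol V' p')
  · rw [Set.indicator_of_mem (show V' ∈ {V' : GaugeField (F.P p.K) (k + 1) (SU N) |
        ∀ c ∈ D, ∃ p' ∈ R c, ε'' ≤ dist1 (GaugeField.plaqHol V' p')} from h)]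
    exact (prod_one_sub_chiFactor_mem F N ν p g k D V').2
  · rw [Set.indicator_of_notMem (show V' ∉ {V' : GaugeField (F.P p.K) (k + 1) (SU N) |
        ∀ c ∈ D, ∃ p' ∈ R c, ε'' ≤ dist1 (GaugeField.plaqHol V' p')} from h)]
    push Not at h
    obtain ⟨c, hcD, hc⟩ := h
    have h1 : chiFactor F N ν p g k c V' = 1 := hreg c hcD V' fun p' hp' => hc p' hp'
    rw [Finset.prod_eq_zero hcD (by rw [h1, sub_self])]

/-- The simultaneous coarse large-field events are measurable. [folklore] -/
theorem measurableSet_forall_exists_largeField (D : Finset (Iχ F ν p g k)) (R : Iχ F ν p g k → Finset (Plaq (F.P p.K) (k + 1)))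
    (ε'' : ℝ) :
    MeasurableSet {V' : GaugeField (F.P p.K) (k + 1) (SU N) | ∀ c ∈ D, ∃ p' ∈ R c, ε'' ≤ dist1 (GaugeField.plaqHol V' p')} := by
  have : {V' : GaugeField (F.P p.K) (k + 1) (SU N) | ∀ c ∈ D, ∃ p' ∈ R c, ε'' ≤ dist1 (GaugeField.plaqHol V' p')} =
      ⋂ c ∈ D, ⋃ p' ∈ R c, {V' : GaugeField (F.P p.K) (k + 1) (SU N) | ε'' ≤ dist1 (GaugeField.plaqHol V' p')} := by
    ext V'; simp
  rw [this]
  exact Finset.measurableSet_biInter D fun c _ =>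
    Finset.measurableSet_biUnion (R c) fun p' _ => measurableSet_largeField F N p k ε'' p'

end Letter

/-! ## §3 On the graph and at the first step: one Peierls factor PER PINNED CUBE -/

section FirstStep

variable (F : T4Family) (N : ℕ) [NeZero N] (ν : Stage7Numerics) (M : ℕ) (p : B12.RunParams) (g : ℕ → ℝ)

/-- **THE FAMILY-PINNED (3.2) LABELS AGAINST ANY NON-NEGATIVE OLD PIECE, ON THE GRAPH `V′ = Ū`** (any step `k`): modulo `IsZetaAbsLeOne` and the
regularity letters of the pinned cubes,
`|∫ (Σ_{t : D ⊆ P(t)} ω s t (U,Ū))·f dU| ≤ ∫_{∀ c∈D, ∃ p′∈R c, ε″ ≤ |Ū(∂p′)−1|} f dU`. [folklore] -/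
theorem abs_integral_sum_ωOfRecord_filter_superset_mul_le (k : ℕ) (A₁ : ℝ) {ζ : ZetaOfRecord F N ν M}
    (hζ : IsZetaAbsLeOne F N ν M ζ) (s : SeqOfRecord F ν M g p.K k) (D : Finset (Iχ F ν p g k))
    (R : Iχ F ν p g k → Finset (Plaq (F.P p.K) (k + 1))) (ε'' : ℝ)
    (hreg : ∀ c ∈ D, ∀ V' : GaugeField (F.P p.K) (k + 1) (SU N),
      (∀ p' ∈ R c, dist1 (GaugeField.plaqHol V' p') < ε'') → chiFactor F N ν p g k c V' = 1)
    {f : GaugeField (F.P p.K) k (SU N) → ℝ} (hf0 : ∀ U, 0 ≤ f U) (hf : Integrable f (fieldMeasure (F.P p.K) k (SU N))) :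
    |∫ U, (∑ t ∈ Finset.univ.filter (fun t : LbOfRecord F ν p g k => D ⊆ t.1),
        ωOfRecord F N ν M p g k A₁ ζ s t U ((avOfRecord F N p.K k).avg U)) * f U ∂(fieldMeasure (F.P p.K) k (SU N))| ≤
      ∫ U in {U | ∀ c ∈ D, ∃ p' ∈ R c, ε'' ≤ dist1 (GaugeField.plaqHol ((avOfRecord F N p.K k).avg U) p')}, f U
        ∂(fieldMeasure (F.P p.K) k (SU N)) := by
  set T : Set (GaugeField (F.P p.K) (k + 1) (SU N)) :=
    {V' | ∀ c ∈ D, ∃ p' ∈ R c, ε'' ≤ dist1 (GaugeField.plaqHol V' p')} with hT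
  set S : Set (GaugeField (F.P p.K) k (SU N)) :=
    {U | ∀ c ∈ D, ∃ p' ∈ R c, ε'' ≤ dist1 (GaugeField.plaqHol ((avOfRecord F N p.K k).avg U) p')} with hS
  have hSm : MeasurableSet S :=
    (measurableSet_forall_exists_largeField F N ν p g k D R ε'').preimage (avOfRecord_measurable F N p.K k)
  rw [← integral_indicator hSm, ← Real.norm_eq_abs]
  refine norm_integral_le_of_norm_le (hf.indicator hSm) (ae_of_all _ fun U => ?_)
  rw [Real.norm_eq_abs, abs_mul, abs_of_nonneg (hf0 U)]
  have hind : Set.indicator S f U = Set.indicator T (fun _ => (1 : ℝ)) ((avOfRecord F N p.K k).avg U) * f U := by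
    by_cases hU : U ∈ S
    · rw [Set.indicator_of_mem hU, Set.indicator_of_mem (show (avOfRecord F N p.K k).avg U ∈ T from hU), one_mul]
    · rw [Set.indicator_of_notMem hU, Set.indicator_of_notMem (show (avOfRecord F N p.K k).avg U ∉ T from hU), zero_mul]
  rw [hind]
  exact mul_le_mul_of_nonneg_right
    ((abs_sum_ωOfRecord_filter_superset_le F N ν M p g k A₁ hζ s D U _).trans
      (prod_one_sub_chiFactor_le_indicator F N ν p g k D R ε'' hreg _)) (hf0 U)

/-- **THE FIRST 𝐑𝐓 STEP PINS A FAMILY OF (3.2) LARGE-FIELD CUBES WITH ONE PEIERLS FACTOR PER CUBE** (the COST side of the (α)-road's cost–volume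
bookkeeping for the pinned (3.2) labels, first step).  With the `δ₀ > 0`, `C ≥ 0` of n20-d's `N20LCSAvgCellPeierls.gibbsMeasure_largeFieldCells_dist1_avgFun_le`
(functions of `N`, `L` only): on every torus `F.P K` (`K ≥ 1`), for `g₀⁻² ≥ 4N`, every `E`, every residual fluctuation factor obeying `IsZetaAbsLeOne`,
every level-`0` sequence `s`, every finite family `D` of χ₁-cubes carrying regularity letters with PAIRWISE DISJOINT regions `R c` of at most `m`
level-`1` plaquettes and a common threshold `ε″ ≥ 0`:
`|∫ (Σ_{t : D ⊆ P(t)} ω s t (U, Ū)) ρ₀ dU| ≤ (m · e^{C·δ₀ − δ₀·g₀⁻²·ε″²∕(2N)})^{#D} · ∫ ρ₀ dU`. [folklore] -/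
theorem abs_integral_pinnedLargeFamily_rhoZero_le :
    ∃ δ₀ : ℝ, 0 < δ₀ ∧ ∃ C : ℝ, 0 ≤ C ∧ ∀ (_hK : 1 ≤ p.K) (g₀ E : ℝ), 4 * N ≤ g₀⁻¹ ^ 2 →
      ∀ (A₁ : ℝ) {ζ : ZetaOfRecord F N ν M}, IsZetaAbsLeOne F N ν M ζ →
      ∀ (s : SeqOfRecord F ν M g p.K 0) (D : Finset (Iχ F ν p g 0)) (R : Iχ F ν p g 0 → Finset (Plaq (F.P p.K) 1))
        (m : ℕ) (ε'' : ℝ), 0 ≤ ε'' → (∀ c ∈ D, (R c).card ≤ m) →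
        (∀ c₁ ∈ D, ∀ c₂ ∈ D, c₁ ≠ c₂ → Disjoint (R c₁) (R c₂)) →
        (∀ c ∈ D, ∀ V' : GaugeField (F.P p.K) 1 (SU N),
          (∀ p' ∈ R c, dist1 (GaugeField.plaqHol V' p') < ε'') → chiFactor F N ν p g 0 c V' = 1) →
        |∫ U, (∑ t ∈ Finset.univ.filter (fun t : LbOfRecord F ν p g 0 => D ⊆ t.1),
            ωOfRecord F N ν M p g 0 A₁ ζ s t U ((avOfRecord F N p.K 0).avg U)) * rhoZeroOfRecord F N p.K g₀ E U
            ∂(fieldMeasure (F.P p.K) 0 (SU N))| ≤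
          ((m : ℝ) * Real.exp (C * δ₀ - δ₀ * g₀⁻¹ ^ 2 * (ε'' ^ 2 / (2 * (Fintype.card (Fin N) : ℝ))))) ^ D.card *
            ∫ U, rhoZeroOfRecord F N p.K g₀ E U ∂(fieldMeasure (F.P p.K) 0 (SU N)) := by
  classical
  obtain ⟨δ₀, hδ₀, C, hC, h⟩ := N20LCSAvgCellPeierls.gibbsMeasure_largeFieldCells_dist1_avgFun_le N F.L
  refine ⟨δ₀, hδ₀, C, hC, fun hK g₀ E hg A₁ ζ hζ s D R m ε'' hε hm hdisj hreg => ?_⟩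
  have hβ0 : (0 : ℝ) ≤ g₀⁻¹ ^ 2 := sq_nonneg _
  haveI := T4GenFunBounds.isProbabilityMeasure_gibbsMeasure (G := SU N) (F.P p.K) hβ0
  have hρ0 : ∀ U, 0 ≤ rhoZeroOfRecord F N p.K g₀ E U := fun U => (rhoZeroOfRecord_pos F N p.K g₀ E U).le
  have hρi : Integrable (rhoZeroOfRecord F N p.K g₀ E) (fieldMeasure (F.P p.K) 0 (SU N)) :=
    (Missing.integrable_boltzmann RegularGaugeGroup.measurable_reTr (F.P p.K) hβ0).const_mul _
  have hI0 : 0 ≤ ∫ U, rhoZeroOfRecord F N p.K g₀ E U ∂(fieldMeasure (F.P p.K) 0 (SU N)) := integral_nonneg hρ0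
  have h1 := abs_integral_sum_ωOfRecord_filter_superset_mul_le F N ν M p g 0 A₁ hζ s D R ε'' hreg hρ0 hρi
  have hSm : MeasurableSet {U : cfgOfRecord F N p.K 0 |
      ∀ c ∈ D, ∃ p' ∈ R c, ε'' ≤ dist1 (GaugeField.plaqHol ((avOfRecord F N p.K 0).avg U) p')} :=
    (measurableSet_forall_exists_largeField F N ν p g 0 D R ε'').preimage (avOfRecord_measurable F N p.K 0)
  refine h1.trans ?_
  rw [setIntegral_rhoZeroOfRecord F N p.K g₀ E hSm]
  refine mul_le_mul_of_nonneg_right ?_ hI0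
  have hmK : 1 ≤ (F.P p.K).m + (F.P p.K).K := by
    simp only [T4Family.P_m, T4Family.P_K]; omega
  exact h (F.P p.K) (T4Family.P_d F p.K) (T4Family.P_L F p.K) hmK (g₀⁻¹ ^ 2) hg ε'' hε D R m hm hdisj

end FirstStep

end Summit.QuantumFields.YangMills.BalabanUVNodes.N20LCSLargeFieldFamilies

end

/-! ### Erratum (g4, 2026-08-27) — citation pointer, prose only
In the prose of this file «[Balaban1985PropagatorsII] Thm 1» ∕ «CMP 99 (1985) 389–434» denotes T. Bałaban, *The variational problem and
background fields in renormalization group method for lattice gauge theories*, Commun. Math. Phys. **102** (1985) 277–309 — bib key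
`Balaban1985Variational` —, Theorem 1 p. 279 (for data with `|∂V(p′) − 1| < ε₁ ≤ a₁` there is a minimal orbit in
`U_k({𝔅_j}, B₃ε₁) ∩ 𝔘_k(𝔅_k, V)`, the unique critical orbit for `B₃ε₁ ≤ ε₀ ≤ a₀`, with the local regularity (9)–(10)); there is no bib key
`Balaban1985PropagatorsII`.  The regularity letter `hreg` is that theorem's shape at def-R's (2.16) problem.  Statements are unaffected. -/
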